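import Mathlib
import HarnessLib
import Summits.Ventures.LatticeQCDFlow.Scoring.PairAcceptanceVariance
import Summits.Ventures.LatticeQCDFlow.Scoring.BlockProdSharedMarginals

/-!
# LatticeQCDFlow / Scoring — Hoeffding's variance decomposition for an order-2 U-statistic of
# `n` i.i.d. proposals, in finite-sum form: `Var U = (2ζ₂ + 4(n − 2)ζ₁)/(n(n − 1))`

HONEST FRAMING: exact (Metropolis-corrected) sampling algorithms for lattice gauge theory;
figures of merit are autocorrelation/cost numbers at stated couplings and volumes; no
continuum-physics claim.

Venture `LatticeQCDFlow` (cell pub-lqcd), sub-topic `Scoring`; FANOUT row 3 (`s0-u1-a`, S0-B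
implementation A, GEN-8).  Our finite-sum formalisation of a PUBLISHED identity — Hoeffding (1948,
Ann. Math. Statist. 19, 293–325, §5: the variance of a U-statistic, here order `m = 2`, and the
bounds `m²ζ₁/n ≤ Var U ≤ mζ_m/n`), NAMED ONLY as the printed counterpart; NO definition is
introduced (`varLaw` is row 29's `Scaling/VarianceLaws`).  It generalises row 3's
`Scoring/PairAcceptanceVariance` (GEN-7, imported: the kernel `min(w, w′)`, an INEQUALITY with
every non-disjoint partner pair bounded by `1`) to ANY symmetric kernel and to the EXACT law; the
partner pairs sharing one index are handled by row 3's `Scoring/BlockProdSharedMarginals`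
(imported).  Used by `Scoring/PairAcceptanceVarianceSharp` (kernel `min(w, w′)`: the sharp
acceptance error bar) and available for the other pair statistics of the cell (Gini mean
difference `|w − w′|` = twice the acceptance deficit, `(w − w′)²` of mean `2(1/ESS − 1)`).

## Setting (finite configuration space `X`; a law `q` on `X` with `Σ q = 1`; a SYMMETRIC kernel
## `F : X → X → ℝ`; `n ≥ 2` i.i.d. draws `φ : Fin n → X` with law `blockProd (fun _ ↦ q)`;
## `U(φ) = Σ_{(i,j) ∈ offDiag} F(φ_i, φ_j) / (n(n−1))`)

Write `μ = Σ_xΣ_y q_x q_y F(x,y)` (`= E U`), `h(x) = Σ_y q_y F(x,y)` (the conditional mean, Hoeffding's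
projection), `c₁ = Σ_x q_x h(x)²`, `c₂ = Σ_xΣ_y q_x q_y F(x,y)²`, `ζ₁ = c₁ − μ² = Var_q h`,
`ζ₂ = c₂ − μ² = Var_{q⊗q} F`.

* `sum_blockProd_mul_offDiag_kernel` — `E[Σ_{offDiag} F] = n(n−1)·μ` (unbiasedness);
* partner-pair second moments: `sum_blockProd_mul_kernel_mul_kernel_disjoint` (`μ²`),
  `sum_blockProd_mul_kernel_mul_self` / `sum_blockProd_mul_kernel_mul_swap` (`c₂`),
  `sum_blockProd_mul_kernel_mul_kernel_shared` / `sum_blockProd_mul_kernel_mul_kernel_of_shared`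
  (`c₁`: condition on the shared draw);
* **`variance_ustat₂_eq`** — for `n ≥ 2`:
  `E[(U − μ)²] = (2(c₂ − μ²) + 4(n − 2)(c₁ − μ²)) / (n(n − 1))`: of the `n(n−1)` ordered partner
  pairs of an ordered pair, `(n−2)(n−3)` are disjoint from it, `2` coincide with it as a set,
  `4(n−2)` share exactly one index;
* the projections `0 ≤ 2ζ₁ ≤ ζ₂` and the sandwich `4ζ₁/n ≤ Var U ≤ 2ζ₂/n` are in
  `Scoring/UStatisticProjections`.

NOT CLAIMED: higher-order kernels (`m ≥ 3`); the monotonicity of `n·Var U` in `n`; asymptotic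
normality; anything measure-theoretic (finite sums only); nothing about any statistic of ours.
-/

namespace Summit.Ventures.LatticeQCDFlow.Scoring

open Finset
open Summit.Ventures.LatticeQCDFlow.Theory2

/-! ### Partner-pair moments of an order-2 U-statistic -/

section UStat

variable {X : Type*} [Fintype X] {n : ℕ}

/-- **Unbiasedness**: `E[Σ_{(i,j) ∈ offDiag} F(φ_i, φ_j)] = #offDiag · E_{q⊗q} F`. [folklore] -/
theorem sum_blockProd_mul_offDiag_kernel (q : X → ℝ) (hq1 : ∑ x, q x = 1) (F : X → X → ℝ) :
    ∑ φ : Fin n → X, blockProd (fun _ => q) φ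
        * ∑ z ∈ (univ : Finset (Fin n)).offDiag, F (φ z.1) (φ z.2)
      = ((univ : Finset (Fin n)).offDiag.card : ℝ) * ∑ x, ∑ y, q x * q y * F x y := by
  have h : ∀ z ∈ (univ : Finset (Fin n)).offDiag,
      ∑ φ : Fin n → X, blockProd (fun _ => q) φ * F (φ z.1) (φ z.2) = ∑ x, ∑ y, q x * q y * F x y :=
    fun z hz => sum_blockProd_mul_apply₂ (fun _ : Fin n => q) (fun _ => hq1) F (mem_offDiag.mp hz).2.2
  calc ∑ φ : Fin n → X, blockProd (fun _ => q) φ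
        * ∑ z ∈ (univ : Finset (Fin n)).offDiag, F (φ z.1) (φ z.2)
      = ∑ φ : Fin n → X, ∑ z ∈ (univ : Finset (Fin n)).offDiag,
          blockProd (fun _ => q) φ * F (φ z.1) (φ z.2) := sum_congr rfl fun φ _ => mul_sum _ _ _
    _ = ∑ z ∈ (univ : Finset (Fin n)).offDiag, ∑ φ : Fin n → X,
          blockProd (fun _ => q) φ * F (φ z.1) (φ z.2) := sum_comm
    _ = _ := by rw [sum_congr rfl h, sum_const, nsmul_eq_mul]

/-- **A disjoint partner pair contributes `μ²`**: for pairwise distinct `i, j, k, l`,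
`E[F(φ_i, φ_j)·F(φ_k, φ_l)] = μ²`. [folklore] -/
theorem sum_blockProd_mul_kernel_mul_kernel_disjoint (q : X → ℝ) (hq1 : ∑ x, q x = 1)
    (F : X → X → ℝ) {i j k l : Fin n} (hij : i ≠ j) (hik : i ≠ k) (hil : i ≠ l) (hjk : j ≠ k)
    (hjl : j ≠ l) (hkl : k ≠ l) :
    ∑ φ : Fin n → X, blockProd (fun _ => q) φ * (F (φ i) (φ j) * F (φ k) (φ l))
      = (∑ x, ∑ y, q x * q y * F x y) ^ 2 := by
  rw [sq]
  exact sum_blockProd_mul_apply₂_mul_apply₂ (fun _ : Fin n => q) (fun _ => hq1) F F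
    hij hik hil hjk hjl hkl

/-- **The coincident partner contributes `c₂ = E_{q⊗q} F²`.** [folklore] -/
theorem sum_blockProd_mul_kernel_mul_self (q : X → ℝ) (hq1 : ∑ x, q x = 1) (F : X → X → ℝ)
    {i j : Fin n} (hij : i ≠ j) :
    ∑ φ : Fin n → X, blockProd (fun _ => q) φ * (F (φ i) (φ j) * F (φ i) (φ j))
      = ∑ x, ∑ y, q x * q y * F x y ^ 2 :=
  calc _ = ∑ x, ∑ y, q x * q y * (F x y * F x y) :=
        sum_blockProd_mul_apply₂ (fun _ : Fin n => q) (fun _ => hq1) (fun x y => F x y * F x y) hij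
    _ = _ := sum_congr rfl fun x _ => sum_congr rfl fun y _ => by rw [sq]

/-- **The swapped partner contributes `c₂`** as well, for a symmetric kernel. [folklore] -/
theorem sum_blockProd_mul_kernel_mul_swap (q : X → ℝ) (hq1 : ∑ x, q x = 1) {F : X → X → ℝ}
    (hF : ∀ x y, F x y = F y x) {i j : Fin n} (hij : i ≠ j) :
    ∑ φ : Fin n → X, blockProd (fun _ => q) φ * (F (φ i) (φ j) * F (φ j) (φ i))
      = ∑ x, ∑ y, q x * q y * F x y ^ 2 :=
  calc _ = ∑ φ : Fin n → X, blockProd (fun _ => q) φ * (F (φ i) (φ j) * F (φ i) (φ j)) :=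
        sum_congr rfl fun φ _ => by rw [hF (φ j) (φ i)]
    _ = _ := sum_blockProd_mul_kernel_mul_self q hq1 F hij

/-- **A partner pair sharing exactly one index contributes `c₁ = E_q h²`**: for pairwise distinct
`i, j, k`, `E[F(φ_i, φ_j)·F(φ_i, φ_k)] = Σ_x q_x (Σ_y q_y F(x, y))²` — condition on the shared draw.
[folklore] -/
theorem sum_blockProd_mul_kernel_mul_kernel_shared (q : X → ℝ) (hq1 : ∑ x, q x = 1)
    (F : X → X → ℝ) {i j k : Fin n} (hij : i ≠ j) (hik : i ≠ k) (hjk : j ≠ k) :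
    ∑ φ : Fin n → X, blockProd (fun _ => q) φ * (F (φ i) (φ j) * F (φ i) (φ k))
      = ∑ x, q x * (∑ y, q y * F x y) ^ 2 :=
  calc _ = ∑ x, q x * ((∑ y, q y * F x y) * ∑ z, q z * F x z) :=
        sum_blockProd_mul_apply₂_mul_apply₂_shared (fun _ : Fin n => q) (fun _ => hq1) F F hij hik hjk
    _ = _ := sum_congr rfl fun x _ => by rw [sq]

/-- The four positions in which an ordered pair `(k, l)` can share exactly one index with `(i, j)`,
reduced to `sum_blockProd_mul_kernel_mul_kernel_shared` by the symmetry of the kernel. [folklore] -/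
theorem sum_blockProd_mul_kernel_mul_kernel_of_shared (q : X → ℝ) (hq1 : ∑ x, q x = 1)
    {F : X → X → ℝ} (hF : ∀ x y, F x y = F y x) {i j k l : Fin n} (hij : i ≠ j) (hkl : k ≠ l)
    (hshare : k = i ∨ k = j ∨ l = i ∨ l = j) (hne : ¬(k = i ∧ l = j)) (hne' : ¬(k = j ∧ l = i)) :
    ∑ φ : Fin n → X, blockProd (fun _ => q) φ * (F (φ i) (φ j) * F (φ k) (φ l))
      = ∑ x, q x * (∑ y, q y * F x y) ^ 2 := by
  rcases hshare with hk | hk | hl | hl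
  · -- `k = i`: shared index `i`, the others `j`, `l`
    rw [hk]
    exact sum_blockProd_mul_kernel_mul_kernel_shared q hq1 F hij (fun h => hkl (hk.trans h))
      (fun h => hne ⟨hk, h.symm⟩)
  · -- `k = j`: shared index `j`, the others `i`, `l`
    rw [hk]
    calc _ = ∑ φ : Fin n → X, blockProd (fun _ => q) φ * (F (φ j) (φ i) * F (φ j) (φ l)) :=
          sum_congr rfl fun φ _ => by rw [hF (φ i) (φ j)]
      _ = _ := sum_blockProd_mul_kernel_mul_kernel_shared q hq1 F hij.symm
          (fun h => hkl (hk.trans h)) (fun h => hne' ⟨hk, h.symm⟩)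
  · -- `l = i`: shared index `i`, the others `j`, `k`
    rw [hl]
    calc _ = ∑ φ : Fin n → X, blockProd (fun _ => q) φ * (F (φ i) (φ j) * F (φ i) (φ k)) :=
          sum_congr rfl fun φ _ => by rw [hF (φ k) (φ i)]
      _ = _ := sum_blockProd_mul_kernel_mul_kernel_shared q hq1 F hij
          (fun h => hkl (h.symm.trans hl.symm)) (fun h => hne' ⟨h.symm, hl⟩)
  · -- `l = j`: shared index `j`, the others `i`, `k`
    rw [hl]
    calc _ = ∑ φ : Fin n → X, blockProd (fun _ => q) φ * (F (φ j) (φ i) * F (φ j) (φ k)) :=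
          sum_congr rfl fun φ _ => by rw [hF (φ i) (φ j), hF (φ k) (φ j)]
      _ = _ := sum_blockProd_mul_kernel_mul_kernel_shared q hq1 F hij.symm
          (fun h => hkl (h.symm.trans hl.symm)) (fun h => hne ⟨h.symm, hl⟩)

/-! ### Hoeffding's decomposition -/

/-- **Hoeffding's variance decomposition, order 2, finite form.**  For a law `q` (`Σ q = 1`), a
symmetric kernel `F` and `n ≥ 2` i.i.d. draws:
`E[(U − μ)²] = (2(c₂ − μ²) + 4(n − 2)(c₁ − μ²)) / (n(n − 1))` where
`U = Σ_{offDiag} F(φ_i, φ_j)/(n(n−1))`, `μ = E_{q⊗q} F`, `c₂ = E_{q⊗q} F²`, `c₁ = E_q h²`,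
`h(x) = Σ_y q_y F(x, y)`.  (Hoeffding 1948: `Var U = (4(n−2)ζ₁ + 2ζ₂)/(n(n−1))`, `ζ₁ = c₁ − μ²`,
`ζ₂ = c₂ − μ²`.) [folklore] -/
theorem variance_ustat₂_eq (q : X → ℝ) (hq1 : ∑ x, q x = 1) {F : X → X → ℝ}
    (hF : ∀ x y, F x y = F y x) (hn : 2 ≤ n) :
    ∑ φ : Fin n → X, blockProd (fun _ => q) φ
        * ((∑ z ∈ (univ : Finset (Fin n)).offDiag, F (φ z.1) (φ z.2)) / (n * (n - 1))
            - ∑ x, ∑ y, q x * q y * F x y) ^ 2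
      = (2 * ((∑ x, ∑ y, q x * q y * F x y ^ 2) - (∑ x, ∑ y, q x * q y * F x y) ^ 2)
          + 4 * (n - 2) * ((∑ x, q x * (∑ y, q y * F x y) ^ 2)
            - (∑ x, ∑ y, q x * q y * F x y) ^ 2)) / (n * (n - 1)) := by
  classical
  set O : Finset (Fin n × Fin n) := (univ : Finset (Fin n)).offDiag with hOdef
  set h : (Fin n × Fin n) → (Fin n → X) → ℝ := fun z φ => F (φ z.1) (φ z.2) with hhdef
  set a := ∑ x, ∑ y, q x * q y * F x y with hadef
  set c₂ := ∑ x, ∑ y, q x * q y * F x y ^ 2 with hc₂def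
  set c₁ := ∑ x, q x * (∑ y, q y * F x y) ^ 2 with hc₁def
  have h2 : (2 : ℝ) ≤ n := by exact_mod_cast hn
  have hNpos : (0 : ℝ) < n * (n - 1) := by
    have : (0 : ℝ) < n := by linarith
    have : (0 : ℝ) < n - 1 := by linarith
    positivity
  have hOcard : (O.card : ℝ) = n * (n - 1) := by
    rw [hOdef, offDiag_card, card_univ, Fintype.card_fin, Nat.cast_sub (Nat.le_mul_self n)]
    push_cast; ring
  have hbp1 : ∑ φ : Fin n → X, blockProd (fun _ => q) φ = 1 := by
    rw [sum_blockProd]; simp [hq1]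
  -- mean
  have hmean : ∑ φ : Fin n → X, blockProd (fun _ => q) φ * ∑ z ∈ O, h z φ = n * (n - 1) * a := by
    rw [← hOcard]; exact sum_blockProd_mul_offDiag_kernel q hq1 F
  -- second moment, exactly
  have hsecond : ∑ φ : Fin n → X, blockProd (fun _ => q) φ * (∑ z ∈ O, h z φ) ^ 2
      = n * (n - 1) * ((n - 2) * (n - 3) * a ^ 2 + 2 * c₂ + (4 * n - 8) * c₁) := by
    have hexp : ∀ φ : Fin n → X, blockProd (fun _ => q) φ * (∑ z ∈ O, h z φ) ^ 2
        = ∑ z ∈ O, ∑ z' ∈ O, blockProd (fun _ => q) φ * (h z φ * h z' φ) := by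
      intro φ
      rw [sq, sum_mul_sum, mul_sum]
      exact sum_congr rfl fun z _ => mul_sum _ _ _
    simp_rw [hexp]
    rw [sum_comm]
    have hz : ∀ z ∈ O, ∑ φ : Fin n → X, ∑ z' ∈ O, blockProd (fun _ => q) φ * (h z φ * h z' φ)
        = (n - 2) * (n - 3) * a ^ 2 + 2 * c₂ + (4 * n - 8) * c₁ := by
      intro z hzO
      rw [sum_comm]
      obtain ⟨-, -, hij⟩ := mem_offDiag.mp hzO
      set D : Finset (Fin n × Fin n) := ((univ : Finset (Fin n)) \ {z.1, z.2}).offDiag with hDdef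
      set C : Finset (Fin n × Fin n) := {z, z.swap} with hCdef
      have hDsub : D ⊆ O := by
        intro z' hz'
        rw [hDdef, mem_offDiag] at hz'
        rw [hOdef, mem_offDiag]
        exact ⟨mem_univ _, mem_univ _, hz'.2.2⟩
      have hzs : z ≠ z.swap := fun e => hij (congrArg Prod.fst e)
      have hCsub : C ⊆ O \ D := by
        intro z' hz'
        rw [hCdef, mem_insert, mem_singleton] at hz'
        rw [mem_sdiff, hOdef, mem_offDiag, hDdef, mem_offDiag, mem_sdiff, mem_insert]
        rcases hz' with rfl | rfl
        · exact ⟨⟨mem_univ _, mem_univ _, hij⟩, fun hD => hD.1.2 (Or.inl rfl)⟩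
        · refine ⟨⟨mem_univ _, mem_univ _, fun e => hij e.symm⟩, fun hD => hD.1.2 ?_⟩
          rw [mem_singleton]
          exact Or.inr rfl
      obtain ⟨hDcard, hRcard⟩ := card_offDiag_sdiff_pair hij
      have hCcard : C.card = 2 := by rw [hCdef]; exact card_pair hzs
      have hRcard' : (((O \ D) \ C).card : ℝ) = 4 * n - 8 := by
        rw [card_sdiff_of_subset hCsub, Nat.cast_sub (card_le_card hCsub), hCcard, hOdef, hDdef,
          hRcard]
        push_cast; ring
      rw [← sum_sdiff hDsub, ← sum_sdiff hCsub]
      -- disjoint partners: exactly `μ²` each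
      have hDsum : ∑ z' ∈ D, ∑ φ : Fin n → X, blockProd (fun _ => q) φ * (h z φ * h z' φ)
          = (n - 2) * (n - 3) * a ^ 2 := by
        have hterm : ∀ z' ∈ D, ∑ φ : Fin n → X, blockProd (fun _ => q) φ * (h z φ * h z' φ)
            = a ^ 2 := by
          intro z' hz'
          rw [hDdef, mem_offDiag, mem_sdiff, mem_sdiff, mem_insert, mem_singleton, mem_insert,
            mem_singleton] at hz'
          obtain ⟨⟨-, hk⟩, ⟨-, hl⟩, hkl⟩ := hz'
          obtain ⟨hk1, hk2⟩ := not_or.mp hk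
          obtain ⟨hl1, hl2⟩ := not_or.mp hl
          exact sum_blockProd_mul_kernel_mul_kernel_disjoint q hq1 F hij (Ne.symm hk1) (Ne.symm hl1)
            (Ne.symm hk2) (Ne.symm hl2) hkl
        rw [sum_congr rfl hterm, sum_const, nsmul_eq_mul, hDdef, hDcard]
      -- the two coincident partners `z`, `z.swap`: exactly `c₂` each
      have hCsum : ∑ z' ∈ C, ∑ φ : Fin n → X, blockProd (fun _ => q) φ * (h z φ * h z' φ)
          = 2 * c₂ := by
        rw [hCdef, sum_pair hzs]
        have e1 : ∑ φ : Fin n → X, blockProd (fun _ => q) φ * (h z φ * h z φ) = c₂ :=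
          sum_blockProd_mul_kernel_mul_self q hq1 F hij
        have e2 : ∑ φ : Fin n → X, blockProd (fun _ => q) φ * (h z φ * h z.swap φ) = c₂ :=
          sum_blockProd_mul_kernel_mul_swap q hq1 hF hij
        rw [e1, e2]
        ring
      -- the `4(n − 2)` partners sharing exactly one index: exactly `c₁` each
      have hRsum : ∑ z' ∈ (O \ D) \ C, ∑ φ : Fin n → X, blockProd (fun _ => q) φ * (h z φ * h z' φ)
          = (4 * n - 8) * c₁ := by
        have hterm : ∀ z' ∈ (O \ D) \ C,
            ∑ φ : Fin n → X, blockProd (fun _ => q) φ * (h z φ * h z' φ) = c₁ := by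
          intro z' hz'
          obtain ⟨hOD, hC⟩ := mem_sdiff.mp hz'
          obtain ⟨hO', hD'⟩ := mem_sdiff.mp hOD
          have hkl : z'.1 ≠ z'.2 := by
            rw [hOdef, mem_offDiag] at hO'
            exact hO'.2.2
          have hshare : z'.1 = z.1 ∨ z'.1 = z.2 ∨ z'.2 = z.1 ∨ z'.2 = z.2 := by
            by_contra hcon
            push Not at hcon
            obtain ⟨h1, h2, h3, h4⟩ := hcon
            apply hD'
            rw [hDdef, mem_offDiag, mem_sdiff, mem_sdiff, mem_insert, mem_singleton, mem_insert,
              mem_singleton]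
            exact ⟨⟨mem_univ _, not_or.mpr ⟨h1, h2⟩⟩, ⟨mem_univ _, not_or.mpr ⟨h3, h4⟩⟩, hkl⟩
          have hC' : z' ≠ z ∧ z' ≠ z.swap := by
            rw [hCdef, mem_insert, mem_singleton] at hC
            exact not_or.mp hC
          have hne : ¬(z'.1 = z.1 ∧ z'.2 = z.2) := fun e => hC'.1 (Prod.ext e.1 e.2)
          have hne' : ¬(z'.1 = z.2 ∧ z'.2 = z.1) := fun e => hC'.2 (Prod.ext e.1 e.2)
          exact sum_blockProd_mul_kernel_mul_kernel_of_shared q hq1 hF hij hkl hshare hne hne'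
        rw [sum_congr rfl hterm, sum_const, nsmul_eq_mul, hRcard']
      rw [hDsum, hCsum, hRsum]
      ring
    calc ∑ z ∈ O, ∑ φ : Fin n → X, ∑ z' ∈ O, blockProd (fun _ => q) φ * (h z φ * h z' φ)
        = ∑ z ∈ O, ((n - 2) * (n - 3) * a ^ 2 + 2 * c₂ + (4 * n - 8) * c₁) := sum_congr rfl hz
      _ = n * (n - 1) * ((n - 2) * (n - 3) * a ^ 2 + 2 * c₂ + (4 * n - 8) * c₁) := by
          rw [sum_const, nsmul_eq_mul, hOcard]
  -- assemble: `E[(S/N − a)²] = (E[S²] − (N a)²)/N²`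
  have hn0 : (n : ℝ) ≠ 0 := by positivity
  have hn1 : (n : ℝ) - 1 ≠ 0 := (by linarith : (0 : ℝ) < n - 1).ne'
  have hsq : ∀ φ : Fin n → X, blockProd (fun _ => q) φ
      * ((∑ z ∈ O, h z φ) / (n * (n - 1)) - a) ^ 2
      = (blockProd (fun _ => q) φ * (∑ z ∈ O, h z φ) ^ 2
          - 2 * (n * (n - 1) * a) * (blockProd (fun _ => q) φ * ∑ z ∈ O, h z φ)
          + (n * (n - 1) * a) ^ 2 * blockProd (fun _ => q) φ) / (n * (n - 1)) ^ 2 := by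
    intro φ
    field_simp
    ring
  have hnum : ∑ φ : Fin n → X, (blockProd (fun _ => q) φ * (∑ z ∈ O, h z φ) ^ 2
          - 2 * (n * (n - 1) * a) * (blockProd (fun _ => q) φ * ∑ z ∈ O, h z φ)
          + (n * (n - 1) * a) ^ 2 * blockProd (fun _ => q) φ)
      = (∑ φ : Fin n → X, blockProd (fun _ => q) φ * (∑ z ∈ O, h z φ) ^ 2)
          - (n * (n - 1) * a) ^ 2 := by
    rw [sum_add_distrib, sum_sub_distrib, ← mul_sum, ← mul_sum, hmean, hbp1]
    ring
  show ∑ φ : Fin n → X, blockProd (fun _ => q) φ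
      * ((∑ z ∈ O, h z φ) / (n * (n - 1)) - a) ^ 2
      = (2 * (c₂ - a ^ 2) + 4 * (n - 2) * (c₁ - a ^ 2)) / (n * (n - 1))
  calc ∑ φ : Fin n → X, blockProd (fun _ => q) φ * ((∑ z ∈ O, h z φ) / (n * (n - 1)) - a) ^ 2
      = ((∑ φ : Fin n → X, blockProd (fun _ => q) φ * (∑ z ∈ O, h z φ) ^ 2)
          - (n * (n - 1) * a) ^ 2) / (n * (n - 1)) ^ 2 := by
        simp_rw [hsq]
        rw [← sum_div, hnum]
    _ = (n * (n - 1) * ((n - 2) * (n - 3) * a ^ 2 + 2 * c₂ + (4 * n - 8) * c₁)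
          - (n * (n - 1) * a) ^ 2) / (n * (n - 1)) ^ 2 := by rw [hsecond]
    _ = (2 * (c₂ - a ^ 2) + 4 * (n - 2) * (c₁ - a ^ 2)) / (n * (n - 1)) := by
        field_simp
        ring

end UStat

end Summit.Ventures.LatticeQCDFlow.Scoring
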